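import Mathlib.Analysis.SpecialFunctions.Pow.Real
import Mathlib.Analysis.SpecialFunctions.Integrals.Basic
import Mathlib.MeasureTheory.Integral.IntervalIntegral.Basic
import HarnessLib

/-!
# (E-a) Tier 2 — the mixed-truncation perturbation estimate for the S₈ panel model (piece (B3))

LINE 1 — FRAMING: RH-FREE elementary real analysis (a Schwarz-type bookkeeping inequality for one
bracket of CC2021's eq. (99)); cell rh-crit, corpus C1, seat t4 g4; Tier-2 soundness support for the
(E-a) kernel certificate of `CC2021_section6_enclosures` (cc-lead R127; consumer: cc-iso g4's
(T2b-sound) read-back of the landed data module `ArchKernelTier2Panels.lean`, p447146, whose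
truncation allowance `Combined.W` is sized by exactly this inequality).  bears_on: W-C/W-P (K3
`WindowSpectralBound`, stmt-RiemannHypothesis-19306).  WHAT THIS IS NOT: a certificate, an
enclosure, a statement about prolate functions, or any claim about RH — nothing here bears on the
truth of RH.

## What is proved (theorems only: 0 definitions, 0 named facts)

For `ρ ∈ [1,2]` the eq.-(99) bracket of a mode with derivative `u′` is
`T(ρ) = ρ^{1/2}∫_{ρ⁻¹}^1 (x u′(x))(ρx u′(ρx))dx + ρ^{−3/2}u′(ρ⁻¹) − ρ^{3/2}u′(ρ)`
(t7's `sonineQTerm_prolateFun_eq_frob`: `τ(n)T_n(ρ) = (λ²ψ(1)²/(1−λ²))·2·T(ρ)` with `u′ = u_b′`).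
The Tier-2 model replaces, with THREE different truncations (`ArchCertT2.readMode`):
`x²u′(x) ↦ −G(x)` and `u′(x) ↦ −Fi(x)` on the inner range `x ∈ [½,1]`, `u′(y) ↦ −Fo(y)` on the
outer range `y ∈ [1,2]`, giving the truncated bracket
`T♭(ρ) = ρ^{3/2}(∫_{ρ⁻¹}^1 G(x)Fo(ρx)dx + Fo(ρ)) − ρ^{−3/2}Fi(ρ⁻¹)`.

* `abs_bracket_sub_truncBracket_le` — if `|x²u′ + G| ≤ δG`, `|u′ + Fi| ≤ δi` on `[½,1]` and
  `|u′ + Fo| ≤ δo`, `|u′| ≤ A` on `[1,2]`, `|G| ≤ B` on `[½,1]` (continuity of `u′`, `G`, `Fo` on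
  the two ranges), then for every `ρ ∈ [1,2]`
  `|T(ρ) − T♭(ρ)| ≤ √2·(δG·A + B·δo) + δi + 2√2·δo`
  (`x²u′(x)u′(ρx) − G(x)Fo(ρx) = (x²u′+G)(x)·u′(ρx) − G(x)·(u′+Fo)(ρx)`, interval length `≤ ½`,
  `ρ^{3/2} ≤ 2√2`, `ρ^{−3/2} ≤ 1`); this is the per-mode allowance
  `2.83·(½(tin·Fp + Gs·tout) + tout) + tin` of `ArchCertT2.combine` (`√2 < 1.415`, `2√2 < 2.83`);
* `abs_mul_bracket_sub_le` — the same multiplied by a nonnegative weight `t`;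
* `abs_sum_sub_sum_le_of_le` — summing per-mode allowances over the modes;
* `abs_bracket_sub_truncPoly_le` — the specialization to polynomial truncations written as the
  explicit finite sums `G = Σ_{i<Kin} g_i(1−x)^i`, `Fi = Σ_{i<Kin} f_i(1−x)^i`, `Fo = Σ_{j<Kout} f_j(1−y)^j`
  (the shapes of the companion identity file `ArchKernelS8Identity.lean`, piece (B1));
* `one_sub_sq_mul_sum_eq`, `sq_mul_add_G_eq` — the shifted coefficients `g_i = f_i − 2f_{i−1} + f_{i−2}`
  ARE those of `x²·F_K` truncated at degree `< K`, with the two dropped top monomials explicit, so the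
  inner allowance `δG` is the `F`-tail plus two monomials.

The analogous estimate with ONE inner truncation for both the integral and the endpoint is t7 g3's
`ArchKernelSonineFrobenius.abs_sonineBracket_sub_le`; the mixed version is what the landed data
module needs.  References: CC2021 §5 eq. (99) p. 32 and App. F Lemma F.1 (arXiv Lemma 49) p. 55
(the same Schwarz-type bookkeeping) [cite: ConnesConsani2021, §5 eq. (99) p. 32; App. F Lemma F.1 p. 55].
-/

noncomputable section

open Real MeasureTheory Set intervalIntegral Finset

namespace Literature.NumberTheory.ConnesConsani2021

namespace S8Identity

/-! ## Elementary bounds on `[1,2]` -/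

/-- For `ρ ∈ [1,2]`: `x ∈ [ρ⁻¹,1] ⇒ x ∈ [½,1]` and `ρx ∈ [1,2]`. [cite: ConnesConsani2021, App. F Lemma F.1 p. 55 (ranges of the arguments in (99))] -/
theorem mem_ranges_of_mem_Icc {ρ x : ℝ} (hρ : ρ ∈ Icc (1 : ℝ) 2) (hx : x ∈ Icc ρ⁻¹ 1) :
    x ∈ Icc (1 / 2 : ℝ) 1 ∧ ρ * x ∈ Icc (1 : ℝ) 2 := by
  have hρ0 : 0 < ρ := by linarith [hρ.1]
  have hρih : 1 / 2 ≤ ρ⁻¹ := by rw [one_div, inv_le_inv₀ two_pos hρ0]; exact hρ.2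
  refine ⟨⟨hρih.trans hx.1, hx.2⟩, ?_, ?_⟩
  · calc (1 : ℝ) = ρ * ρ⁻¹ := (mul_inv_cancel₀ hρ0.ne').symm
      _ ≤ ρ * x := mul_le_mul_of_nonneg_left hx.1 hρ0.le
  · calc ρ * x ≤ ρ * 1 := mul_le_mul_of_nonneg_left hx.2 hρ0.le
      _ ≤ 2 := by linarith [hρ.2]

/-- `ρ^{3/2} ≤ 2√2`, `0 ≤ ρ^{3/2}`, `ρ^{−3/2} ≤ 1`, `0 ≤ ρ^{−3/2}` and `ρ^{1/2}·ρ = ρ^{3/2}` for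
`ρ ∈ [1,2]`. [cite: ConnesConsani2021, App. F Lemma F.1 p. 55 (the powers of ρ in (99))] -/
theorem rpow_bounds_of_mem_Icc {ρ : ℝ} (hρ : ρ ∈ Icc (1 : ℝ) 2) :
    ρ ^ (3 / 2 : ℝ) ≤ 2 * Real.sqrt 2 ∧ 0 ≤ ρ ^ (3 / 2 : ℝ) ∧ ρ ^ (-(3 / 2) : ℝ) ≤ 1 ∧
      0 ≤ ρ ^ (-(3 / 2) : ℝ) ∧ ρ ^ (1 / 2 : ℝ) * ρ = ρ ^ (3 / 2 : ℝ) := by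
  have hρ0 : 0 < ρ := by linarith [hρ.1]
  refine ⟨?_, Real.rpow_nonneg hρ0.le _, ?_, Real.rpow_nonneg hρ0.le _, ?_⟩
  · have e : (2 : ℝ) * Real.sqrt 2 = 2 ^ (3 / 2 : ℝ) := by
      rw [show (3 / 2 : ℝ) = 1 + 1 / 2 by norm_num, Real.rpow_add two_pos, Real.rpow_one,
        Real.sqrt_eq_rpow]
    rw [e]; exact Real.rpow_le_rpow hρ0.le hρ.2 (by norm_num)
  · rw [Real.rpow_neg hρ0.le]
    exact inv_le_one_of_one_le₀ (Real.one_le_rpow hρ.1 (by norm_num))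
  · rw [show (3 / 2 : ℝ) = 1 / 2 + 1 by norm_num, Real.rpow_add hρ0, Real.rpow_one]

/-! ## The mixed-truncation estimate -/

/-- **Mixed-truncation perturbation of the eq.-(99) bracket.**  Let `ρ ∈ [1,2]`, `u′` continuous
on `[½,1]` and on `[1,2]`, `G` continuous on `[½,1]`, `Fo` continuous on `[1,2]`, with
`|x²u′(x) + G(x)| ≤ δG`, `|u′(x) + Fi(x)| ≤ δi`, `|G(x)| ≤ B` for `x ∈ [½,1]` and `|u′(y) + Fo(y)| ≤ δo`,
`|u′(y)| ≤ A` for `y ∈ [1,2]`.  Then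
`|(ρ^{1/2}∫_{ρ⁻¹}^1 (xu′(x))(ρxu′(ρx))dx + ρ^{−3/2}u′(ρ⁻¹) − ρ^{3/2}u′(ρ))
   − (ρ^{3/2}(∫_{ρ⁻¹}^1 G(x)Fo(ρx)dx + Fo(ρ)) − ρ^{−3/2}Fi(ρ⁻¹))| ≤ √2(δG·A + B·δo) + δi + 2√2·δo`.
[cite: ConnesConsani2021, §5 eq. (99) p. 32; App. F Lemma F.1 (arXiv Lemma 49) p. 55 (the same Schwarz-type bookkeeping)] -/
theorem abs_bracket_sub_truncBracket_le {u' G Fi Fo : ℝ → ℝ} {δG δi δo A B ρ : ℝ}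
    (hu'in : ContinuousOn u' (Icc (1 / 2) 1)) (hu'out : ContinuousOn u' (Icc 1 2))
    (hGc : ContinuousOn G (Icc (1 / 2) 1)) (hFoc : ContinuousOn Fo (Icc 1 2))
    (hGd : ∀ x ∈ Icc (1 / 2 : ℝ) 1, |x ^ 2 * u' x + G x| ≤ δG)
    (hFi : ∀ x ∈ Icc (1 / 2 : ℝ) 1, |u' x + Fi x| ≤ δi)
    (hB : ∀ x ∈ Icc (1 / 2 : ℝ) 1, |G x| ≤ B)
    (hFo : ∀ y ∈ Icc (1 : ℝ) 2, |u' y + Fo y| ≤ δo)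
    (hA : ∀ y ∈ Icc (1 : ℝ) 2, |u' y| ≤ A)
    (hρ : ρ ∈ Icc (1 : ℝ) 2) :
    |(ρ ^ (1 / 2 : ℝ) * (∫ x in ρ⁻¹..1, (x * u' x) * (ρ * x * u' (ρ * x)))
        + ρ ^ (-(3 / 2) : ℝ) * u' ρ⁻¹ - ρ ^ (3 / 2 : ℝ) * u' ρ)
      - (ρ ^ (3 / 2 : ℝ) * ((∫ x in ρ⁻¹..1, G x * Fo (ρ * x)) + Fo ρ)
        - ρ ^ (-(3 / 2) : ℝ) * Fi ρ⁻¹)|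
      ≤ Real.sqrt 2 * (δG * A + B * δo) + δi + 2 * Real.sqrt 2 * δo := by
  have hρ0 : 0 < ρ := by linarith [hρ.1]
  have hρi0 : 0 < ρ⁻¹ := inv_pos.2 hρ0
  have hρi1 : ρ⁻¹ ≤ 1 := inv_le_one_of_one_le₀ hρ.1
  have hρih : 1 / 2 ≤ ρ⁻¹ := by rw [one_div, inv_le_inv₀ two_pos hρ0]; exact hρ.2
  obtain ⟨h32, h32', hm32, hm32', h12⟩ := rpow_bounds_of_mem_Icc hρ
  -- nonnegativity of the data
  have hone : (1 : ℝ) ∈ Icc (1 / 2 : ℝ) 1 := ⟨by norm_num, le_rfl⟩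
  have hone' : (1 : ℝ) ∈ Icc (1 : ℝ) 2 := ⟨le_rfl, one_le_two⟩
  have hδG : 0 ≤ δG := le_trans (abs_nonneg _) (hGd 1 hone)
  have hδo : 0 ≤ δo := le_trans (abs_nonneg _) (hFo 1 hone')
  have hA0 : 0 ≤ A := le_trans (abs_nonneg _) (hA 1 hone')
  have hB0 : 0 ≤ B := le_trans (abs_nonneg _) (hB 1 hone)
  -- ranges
  have hxin : ∀ x ∈ Icc ρ⁻¹ 1, x ∈ Icc (1 / 2 : ℝ) 1 := fun x hx ↦ (mem_ranges_of_mem_Icc hρ hx).1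
  have hxout : ∀ x ∈ Icc ρ⁻¹ 1, ρ * x ∈ Icc (1 : ℝ) 2 := fun x hx ↦ (mem_ranges_of_mem_Icc hρ hx).2
  -- integrability
  have hmul : ContinuousOn (fun x : ℝ ↦ ρ * x) (Icc ρ⁻¹ 1) :=
    (continuous_const.mul continuous_id).continuousOn
  have hc1 : ContinuousOn (fun x ↦ (x * u' x) * (ρ * x * u' (ρ * x))) (Icc ρ⁻¹ 1) :=
    (continuousOn_id.mul (hu'in.mono hxin)).mul (hmul.mul (hu'out.comp hmul hxout))
  have hc2 : ContinuousOn (fun x ↦ G x * Fo (ρ * x)) (Icc ρ⁻¹ 1) :=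
    (hGc.mono hxin).mul (hFoc.comp hmul hxout)
  have hi1 : IntervalIntegrable (fun x ↦ (x * u' x) * (ρ * x * u' (ρ * x))) volume ρ⁻¹ 1 :=
    hc1.intervalIntegrable_of_Icc hρi1
  have hi1' : IntervalIntegrable (fun x ↦ ρ * (x ^ 2 * u' x * u' (ρ * x))) volume ρ⁻¹ 1 := by
    refine (hi1.congr fun x _ ↦ ?_)
    ring
  have hi2 : IntervalIntegrable (fun x ↦ G x * Fo (ρ * x)) volume ρ⁻¹ 1 :=
    hc2.intervalIntegrable_of_Icc hρi1
  have hi3 : IntervalIntegrable (fun x ↦ x ^ 2 * u' x * u' (ρ * x)) volume ρ⁻¹ 1 := by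
    have := hi1'.const_mul ρ⁻¹
    refine this.congr fun x _ ↦ ?_
    field_simp
  -- rewrite the first integral: `ρ^{1/2}∫(xu′)(ρxu′(ρx)) = ρ^{3/2}∫ x²u′(x)u′(ρx)`
  have hI1 : ρ ^ (1 / 2 : ℝ) * (∫ x in ρ⁻¹..1, (x * u' x) * (ρ * x * u' (ρ * x)))
      = ρ ^ (3 / 2 : ℝ) * ∫ x in ρ⁻¹..1, x ^ 2 * u' x * u' (ρ * x) := by
    have e : (∫ x in ρ⁻¹..1, (x * u' x) * (ρ * x * u' (ρ * x)))
        = ρ * ∫ x in ρ⁻¹..1, x ^ 2 * u' x * u' (ρ * x) := by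
      rw [← intervalIntegral.integral_const_mul]
      refine intervalIntegral.integral_congr fun x _ ↦ ?_
      ring
    rw [e, ← mul_assoc, h12]
  -- the integral difference
  have hI : |(∫ x in ρ⁻¹..1, x ^ 2 * u' x * u' (ρ * x)) - ∫ x in ρ⁻¹..1, G x * Fo (ρ * x)|
      ≤ (δG * A + B * δo) / 2 := by
    rw [← intervalIntegral.integral_sub hi3 hi2]
    have hb : ∀ x ∈ Set.uIoc ρ⁻¹ 1,
        ‖x ^ 2 * u' x * u' (ρ * x) - G x * Fo (ρ * x)‖ ≤ δG * A + B * δo := by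
      intro x hx
      rw [uIoc_of_le hρi1] at hx
      have hx' : x ∈ Icc ρ⁻¹ 1 := ⟨hx.1.le, hx.2⟩
      have e : x ^ 2 * u' x * u' (ρ * x) - G x * Fo (ρ * x)
          = (x ^ 2 * u' x + G x) * u' (ρ * x) - G x * (u' (ρ * x) + Fo (ρ * x)) := by ring
      rw [Real.norm_eq_abs, e]
      refine (abs_sub _ _).trans ?_
      rw [abs_mul, abs_mul]
      exact add_le_add
        (mul_le_mul (hGd x (hxin x hx')) (hA _ (hxout x hx')) (abs_nonneg _) hδG)
        (mul_le_mul (hB x (hxin x hx')) (hFo _ (hxout x hx')) (abs_nonneg _) hB0)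
    have h := intervalIntegral.norm_integral_le_of_norm_le_const hb
    rw [Real.norm_eq_abs] at h
    refine h.trans ?_
    have hlen : |1 - ρ⁻¹| ≤ 1 / 2 := by rw [abs_of_nonneg (by linarith)]; linarith
    have h0 : 0 ≤ δG * A + B * δo := by positivity
    calc (δG * A + B * δo) * |1 - ρ⁻¹| ≤ (δG * A + B * δo) * (1 / 2) :=
          mul_le_mul_of_nonneg_left hlen h0
      _ = (δG * A + B * δo) / 2 := by ring
  -- the two boundary terms
  have hb1 : |ρ ^ (-(3 / 2) : ℝ) * u' ρ⁻¹ + ρ ^ (-(3 / 2) : ℝ) * Fi ρ⁻¹| ≤ δi := by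
    rw [← mul_add, abs_mul, abs_of_nonneg hm32']
    calc ρ ^ (-(3 / 2) : ℝ) * |u' ρ⁻¹ + Fi ρ⁻¹| ≤ 1 * δi :=
          mul_le_mul hm32 (hFi _ ⟨hρih, hρi1⟩) (abs_nonneg _) zero_le_one
      _ = δi := one_mul _
  have hb2 : |ρ ^ (3 / 2 : ℝ) * u' ρ + ρ ^ (3 / 2 : ℝ) * Fo ρ| ≤ 2 * Real.sqrt 2 * δo := by
    rw [← mul_add, abs_mul, abs_of_nonneg h32']
    exact mul_le_mul h32 (hFo ρ hρ) (abs_nonneg _) (by positivity)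
  -- assemble
  rw [hI1]
  set I₁ := ∫ x in ρ⁻¹..1, x ^ 2 * u' x * u' (ρ * x) with hI₁
  set I₂ := ∫ x in ρ⁻¹..1, G x * Fo (ρ * x) with hI₂
  have e : (ρ ^ (3 / 2 : ℝ) * I₁ + ρ ^ (-(3 / 2) : ℝ) * u' ρ⁻¹ - ρ ^ (3 / 2 : ℝ) * u' ρ)
      - (ρ ^ (3 / 2 : ℝ) * (I₂ + Fo ρ) - ρ ^ (-(3 / 2) : ℝ) * Fi ρ⁻¹)
      = ρ ^ (3 / 2 : ℝ) * (I₁ - I₂)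
        + (ρ ^ (-(3 / 2) : ℝ) * u' ρ⁻¹ + ρ ^ (-(3 / 2) : ℝ) * Fi ρ⁻¹)
        - (ρ ^ (3 / 2 : ℝ) * u' ρ + ρ ^ (3 / 2 : ℝ) * Fo ρ) := by ring
  rw [e]
  set B₁ := ρ ^ (-(3 / 2) : ℝ) * u' ρ⁻¹ + ρ ^ (-(3 / 2) : ℝ) * Fi ρ⁻¹ with hB₁
  set B₂ := ρ ^ (3 / 2 : ℝ) * u' ρ + ρ ^ (3 / 2 : ℝ) * Fo ρ with hB₂
  have hAint : |ρ ^ (3 / 2 : ℝ) * (I₁ - I₂)| ≤ Real.sqrt 2 * (δG * A + B * δo) := by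
    rw [abs_mul, abs_of_nonneg h32']
    have h0 : 0 ≤ (δG * A + B * δo) / 2 := by positivity
    calc ρ ^ (3 / 2 : ℝ) * |I₁ - I₂| ≤ (2 * Real.sqrt 2) * ((δG * A + B * δo) / 2) :=
          mul_le_mul h32 hI (abs_nonneg _) (by positivity)
      _ = Real.sqrt 2 * (δG * A + B * δo) := by ring
  have h1 : |ρ ^ (3 / 2 : ℝ) * (I₁ - I₂) + B₁ - B₂| ≤ |ρ ^ (3 / 2 : ℝ) * (I₁ - I₂) + B₁| + |B₂| :=
    abs_sub _ _
  have h2 : |ρ ^ (3 / 2 : ℝ) * (I₁ - I₂) + B₁| ≤ |ρ ^ (3 / 2 : ℝ) * (I₁ - I₂)| + |B₁| :=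
    abs_add_le _ _
  linarith

/-- **The weighted form**: multiplying by a weight `t ≥ 0` (`t = 2λ²ψ(1)²/(1−λ²)` of a mode).
[cite: ConnesConsani2021, §5 eq. (99) p. 32; App. F Lemma F.1 p. 55] -/
theorem abs_mul_bracket_sub_le {u' G Fi Fo : ℝ → ℝ} {δG δi δo A B ρ t : ℝ} (ht : 0 ≤ t)
    (hu'in : ContinuousOn u' (Icc (1 / 2) 1)) (hu'out : ContinuousOn u' (Icc 1 2))
    (hGc : ContinuousOn G (Icc (1 / 2) 1)) (hFoc : ContinuousOn Fo (Icc 1 2))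
    (hGd : ∀ x ∈ Icc (1 / 2 : ℝ) 1, |x ^ 2 * u' x + G x| ≤ δG)
    (hFi : ∀ x ∈ Icc (1 / 2 : ℝ) 1, |u' x + Fi x| ≤ δi)
    (hB : ∀ x ∈ Icc (1 / 2 : ℝ) 1, |G x| ≤ B)
    (hFo : ∀ y ∈ Icc (1 : ℝ) 2, |u' y + Fo y| ≤ δo)
    (hA : ∀ y ∈ Icc (1 : ℝ) 2, |u' y| ≤ A)
    (hρ : ρ ∈ Icc (1 : ℝ) 2) :
    |t * (ρ ^ (1 / 2 : ℝ) * (∫ x in ρ⁻¹..1, (x * u' x) * (ρ * x * u' (ρ * x)))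
        + ρ ^ (-(3 / 2) : ℝ) * u' ρ⁻¹ - ρ ^ (3 / 2 : ℝ) * u' ρ)
      - t * (ρ ^ (3 / 2 : ℝ) * ((∫ x in ρ⁻¹..1, G x * Fo (ρ * x)) + Fo ρ)
        - ρ ^ (-(3 / 2) : ℝ) * Fi ρ⁻¹)|
      ≤ t * (Real.sqrt 2 * (δG * A + B * δo) + δi + 2 * Real.sqrt 2 * δo) := by
  rw [← mul_sub, abs_mul, abs_of_nonneg ht]
  exact mul_le_mul_of_nonneg_left
    (abs_bracket_sub_truncBracket_le hu'in hu'out hGc hFoc hGd hFi hB hFo hA hρ) ht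

/-- **Summing per-mode allowances**: if `|a n − b n| ≤ e n` for every `n < N`, then
`|Σ_{n<N} a n − Σ_{n<N} b n| ≤ Σ_{n<N} e n`. [cite: ConnesConsani2021, §6.3 p. 24 (the finitely many modes of the §6 kernel enclosure)] -/
theorem abs_sum_sub_sum_le_of_le {a b e : ℕ → ℝ} {N : ℕ} (h : ∀ n, n < N → |a n - b n| ≤ e n) :
    |∑ n ∈ range N, a n - ∑ n ∈ range N, b n| ≤ ∑ n ∈ range N, e n := by
  rw [← Finset.sum_sub_distrib]
  refine (Finset.abs_sum_le_sum_abs _ _).trans (Finset.sum_le_sum fun n hn ↦ ?_)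
  exact h n (Finset.mem_range.1 hn)

/-! ## Polynomial truncations (the shapes of `ArchKernelS8Identity.lean`) -/

/-- **Mixed-truncation estimate with polynomial truncations** `G(x) = Σ_{i<Kin} g_i(1−x)^i`,
`Fi(x) = Σ_{i<Kin} f_i(1−x)^i`, `Fo(y) = Σ_{j<Kout} fo_j(1−y)^j` (continuity is automatic); the
hypotheses are the five sup-bounds decoded from the data (`tin`, `tout`, `Fp`, `Gs` of
`ArchCertT2.readMode`).
[cite: ConnesConsani2021, §5 eq. (99) p. 32; App. F Lemma F.1 p. 55; §6.3 p. 24] -/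
theorem abs_bracket_sub_truncPoly_le {u' : ℝ → ℝ} {g f fo : ℕ → ℝ} {Kin Kout : ℕ}
    {δG δi δo A B ρ : ℝ}
    (hu'in : ContinuousOn u' (Icc (1 / 2) 1)) (hu'out : ContinuousOn u' (Icc 1 2))
    (hGd : ∀ x ∈ Icc (1 / 2 : ℝ) 1, |x ^ 2 * u' x + ∑ i ∈ range Kin, g i * (1 - x) ^ i| ≤ δG)
    (hFi : ∀ x ∈ Icc (1 / 2 : ℝ) 1, |u' x + ∑ i ∈ range Kin, f i * (1 - x) ^ i| ≤ δi)
    (hB : ∀ x ∈ Icc (1 / 2 : ℝ) 1, |∑ i ∈ range Kin, g i * (1 - x) ^ i| ≤ B)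
    (hFo : ∀ y ∈ Icc (1 : ℝ) 2, |u' y + ∑ j ∈ range Kout, fo j * (1 - y) ^ j| ≤ δo)
    (hA : ∀ y ∈ Icc (1 : ℝ) 2, |u' y| ≤ A)
    (hρ : ρ ∈ Icc (1 : ℝ) 2) :
    |(ρ ^ (1 / 2 : ℝ) * (∫ x in ρ⁻¹..1, (x * u' x) * (ρ * x * u' (ρ * x)))
        + ρ ^ (-(3 / 2) : ℝ) * u' ρ⁻¹ - ρ ^ (3 / 2 : ℝ) * u' ρ)
      - (ρ ^ (3 / 2 : ℝ) *
          ((∫ x in ρ⁻¹..1, (∑ i ∈ range Kin, g i * (1 - x) ^ i) *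
              (∑ j ∈ range Kout, fo j * (1 - ρ * x) ^ j)) +
            ∑ j ∈ range Kout, fo j * (1 - ρ) ^ j)
        - ρ ^ (-(3 / 2) : ℝ) * ∑ i ∈ range Kin, f i * (1 - ρ⁻¹) ^ i)|
      ≤ Real.sqrt 2 * (δG * A + B * δo) + δi + 2 * Real.sqrt 2 * δo := by
  have hGc : ContinuousOn (fun x : ℝ ↦ ∑ i ∈ range Kin, g i * (1 - x) ^ i) (Icc (1 / 2) 1) :=
    (continuous_finsetSum _ fun i _ ↦ by fun_prop).continuousOn
  have hFoc : ContinuousOn (fun y : ℝ ↦ ∑ j ∈ range Kout, fo j * (1 - y) ^ j) (Icc 1 2) :=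
    (continuous_finsetSum _ fun j _ ↦ by fun_prop).continuousOn
  exact abs_bracket_sub_truncBracket_le (G := fun x ↦ ∑ i ∈ range Kin, g i * (1 - x) ^ i)
    (Fi := fun x ↦ ∑ i ∈ range Kin, f i * (1 - x) ^ i)
    (Fo := fun y ↦ ∑ j ∈ range Kout, fo j * (1 - y) ^ j)
    hu'in hu'out hGc hFoc hGd hFi hB hFo hA hρ

/-! ## The inner truncation of `x²u′`: shifted coefficients and the two dropped top terms -/

/-- **`(1−w)²·Σ_{k<K} f_k w^k = Σ_{i<K} g_i w^i + (f_{K−2} − 2f_{K−1}) w^K + f_{K−1} w^{K+1}`** for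
`K ≥ 2`, where `g_0 = f_0`, `g_1 = f_1 − 2f_0`, `g_i = f_i − 2f_{i−1} + f_{i−2}` (`i ≥ 2`) — the
coefficients `g` of `ArchCertT2.combine` are those of `x²·F` (`x = 1 − w`) truncated at degree
`< K`, and the two dropped terms are explicit (they are part of the inner allowance `tin`).
[cite: ConnesConsani2021, §6.3 p. 24 (in-kernel (E-a) certificate: the inner truncation); §5 eq. (99) p. 32] -/
theorem one_sub_sq_mul_sum_eq {f g : ℕ → ℝ} (hg0 : g 0 = f 0) (hg1 : g 1 = f 1 - 2 * f 0)
    (hg : ∀ i, 2 ≤ i → g i = f i - 2 * f (i - 1) + f (i - 2)) {K : ℕ} (hK : 2 ≤ K) (w : ℝ) :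
    (1 - w) ^ 2 * ∑ k ∈ range K, f k * w ^ k =
      ∑ i ∈ range K, g i * w ^ i + (f (K - 2) - 2 * f (K - 1)) * w ^ K + f (K - 1) * w ^ (K + 1) := by
  induction K, hK using Nat.le_induction with
  | base =>
      simp only [Finset.sum_range_succ, Finset.sum_range_zero, zero_add, hg0, hg1, pow_zero,
        pow_one, Nat.sub_self, show 2 - 1 = 1 from rfl]
      ring
  | succ K hK ih =>
      rw [Finset.sum_range_succ, mul_add, ih, Finset.sum_range_succ, hg K hK,
        show K + 1 - 2 = K - 1 by omega, show K + 1 - 1 = K from rfl]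
      obtain ⟨m, rfl⟩ : ∃ m, K = m + 2 := ⟨K - 2, by omega⟩
      simp only [show m + 2 - 1 = m + 1 from rfl, show m + 2 - 2 = m from rfl]
      ring

/-- Consequently, on the inner range (`x = 1 − w`), the defect of the `G`-truncation splits as
`x²u′(x) + G(x) = x²·(u′(x) + F_K(x)) − ((f_{K−2} − 2f_{K−1}) w^K + f_{K−1} w^{K+1})` with
`F_K(x) = Σ_{k<K} f_k w^k`, `G(x) = Σ_{i<K} g_i w^i`: the inner allowance is the `F`-tail plus two
explicit monomials. [cite: ConnesConsani2021, §6.3 p. 24; §5 eq. (99) p. 32] -/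
theorem sq_mul_add_G_eq {f g : ℕ → ℝ} (hg0 : g 0 = f 0) (hg1 : g 1 = f 1 - 2 * f 0)
    (hg : ∀ i, 2 ≤ i → g i = f i - 2 * f (i - 1) + f (i - 2)) {K : ℕ} (hK : 2 ≤ K)
    (u' : ℝ → ℝ) (x : ℝ) :
    x ^ 2 * u' x + ∑ i ∈ range K, g i * (1 - x) ^ i =
      x ^ 2 * (u' x + ∑ k ∈ range K, f k * (1 - x) ^ k) -
        ((f (K - 2) - 2 * f (K - 1)) * (1 - x) ^ K + f (K - 1) * (1 - x) ^ (K + 1)) := by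
  have h := one_sub_sq_mul_sum_eq hg0 hg1 hg hK (1 - x)
  rw [sub_sub_cancel] at h
  rw [mul_add, h]
  ring

end S8Identity

end Literature.NumberTheory.ConnesConsani2021

end
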